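import Literature.Algebra.EuclideanDomain.EuclideanOrderTypeIndecomposable
import HarnessLib

/-!
# The smallest algorithm factors through principal ideals; finitely many principal ideals force a finite Euclidean
# order type (Fletcher ∕ Clark 2015 Cor. 17 (a)); `θ(x) < ω` forces DCC on principal ideals above `x` (Thm. 16 (a))

Topic `Literature/Algebra/EuclideanDomain`, namespace `Literature.Algebra.EuclideanDomain`.  THEOREMS ONLY (no `def`, no
instance, no named fact), all proved, in the vocabulary of `TransfiniteSmallestAlgorithm.lean` (`samuelSet R α = A_α`,
`samuelRank = θ`) and `EuclideanOrderTypeIndecomposable.lean` (`e(R) = ⨆ z, ((θ z − 1) + 1)`).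

## Source (read at the page)

P. L. Clark, *A note on Euclidean order types*, Order **32** (2015) 157–178 [Clark2015EuclideanOrderTypes] (materialised
`paper:arxiv-1208.0977`, arXiv numbering), VERBATIM.  §2.4 Cor. 12 and §2.5 Prop. 15: «If `R` is Euclidean, the bottom
Euclidean function `φ_R` is isotone» (isotone: «whenever `x` divides `y`, `φ(x) ≤ φ(y)`», and `<` for strict
divisibility).  Theorem 16: «Suppose `R` is Euclidean with `e(R) ≤ ω`. Then: a) For all `x ∈ R•`, `R/(x)` is Artinian. …
Proof. a) If `R/(x)` were not Artinian, there would be a sequence of elements `{x_n}` in `R` with `x₀ = x` and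
`(x_{n+1}) ⊊ (x_n)` for all `n ∈ ℕ` … contradicting `φ(x) ∈ ω`.»  Corollary 17 (Fletcher [Fletcher71]): «a) If `A` is an
Artinian Euclidean ring, then `e(A) < ω`.»  Proof: «The value of `φ_A` at `x ∈ R` depends only on the ideal `(x)`.  But an
Artinian principal ring has only finitely many ideals!  So `e(R) < ω`.»

## What is formalised

* §1 (Prop. 15 ∕ Cor. 12, via Samuel's Prop. 4) `θ` is isotone for divisibility on `A′` (`samuelRank_le_of_dvd`), STRICTLY
  on strict inclusions of principal ideals (`samuelRank_lt_of_dvd_of_span_singleton_ne`), and **depends only on the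
  principal ideal** (`samuelRank_eq_of_span_singleton_eq`).
* §2 (Cor. 17 (a)) if `R` has finitely many principal ideals and is exhausted by its transfinite construction then `θ`
  takes finitely many values, all finite, some finite stage `A_N` is everything, and **`e(R) < ω`**
  (**`iSup_samuelRank_lt_omega0_of_finite_setOf_span_singleton`**; in particular for FINITE rings,
  `iSup_samuelRank_lt_omega0_of_finite`) — the hypothesis «finitely many (principal) ideals» replaces «Artinian
  principal», which implies it.
* §3 (Thm. 16 (a), the chain form) if `θ(x) < ω`, `x ≠ 0`, there is no infinite strictly descending chain of principal
  ideals all containing `x` (`not_exists_chain_of_samuelRank_lt_omega0`): `R/(x)` has DCC on principal ideals.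
-- TODO(general form): the conversions «Artinian principal ⟹ finitely many ideals» and «DCC on principal ideals of the
-- principal ring `R/(x)` ⟹ `IsArtinianRing (R ⧸ (x))`», and Cor. 17 (b) ∕ Thm. 16 (b) (structure theorem) are not done here.

## Mathlib / tree search

Mathlib: `Ideal.span_singleton_le_span_singleton`, `Set.Finite` ∕ `Finset.sup`; no Euclidean order type.  Tree: `TransfiniteSmallestAlgorithm.lean` (`samuelRank_le_samuelRank_mul`, `samuelRank_mul_eq_iff` = Samuel's
Prop. 4 (a), (b) for `θ`, `mem_samuelSet_of_mul_mem`), `TransfiniteSmallestAlgorithmSuperadditive.lean`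
(`exists_samuelRank_eq_of_lt`: the values are downward closed), `LocalPrincipalRingSmallestAlgorithm.lean` (the Artinian
local case `e = ℓ`).
-/

namespace Literature.Algebra.EuclideanDomain

universe u

open Ordinal

variable {R : Type u} [CommRing R]

/-! ## §1 `θ` factors through principal ideals (Prop. 15) -/

/-- **«The bottom Euclidean function is isotone»**: `x ∣ y`, `y ≠ 0`, `y ∈ A′ ⟹ θ(x) ≤ θ(y)` (Samuel's Prop. 4 (a) for `θ`).
[cite: Clark2015EuclideanOrderTypes, Prop. 15 and Cor. 12; Samuel1971, Prop. 4 (a) (p. 284)] -/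
theorem samuelRank_le_of_dvd {x y : R} (hxy : x ∣ y) (hy0 : y ≠ 0) (hy : ∃ α : Ordinal.{u}, y ∈ samuelSet R α) :
    samuelRank x ≤ samuelRank y := by
  obtain ⟨c, rfl⟩ := hxy
  exact samuelRank_le_samuelRank_mul hy hy0

/-- Strict isotonicity: `x ∣ y`, `(y) ≠ (x)`, `y ≠ 0`, `y ∈ A′ ⟹ θ(x) < θ(y)` (Samuel's Prop. 4 (b) for `θ`).
[cite: Clark2015EuclideanOrderTypes, Cor. 12 («isotone»); Samuel1971, Prop. 4 (b) (p. 284)] -/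
theorem samuelRank_lt_of_dvd_of_span_singleton_ne {x y : R} (hxy : x ∣ y) (hne : Ideal.span {y} ≠ Ideal.span {x})
    (hy0 : y ≠ 0) (hy : ∃ α : Ordinal.{u}, y ∈ samuelSet R α) : samuelRank x < samuelRank y := by
  obtain ⟨c, rfl⟩ := hxy
  exact lt_of_le_of_ne (samuelRank_le_samuelRank_mul hy hy0) fun h ↦ hne ((samuelRank_mul_eq_iff hy hy0).1 h.symm)

/-- **«The value of `φ_A` at `x` depends only on the ideal `(x)`»**: `(x) = (y) ⟹ θ(x) = θ(y)` (for `x ∈ A′`).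
[cite: Clark2015EuclideanOrderTypes, proof of Cor. 17 (a); Samuel1971, Prop. 4 (b) (p. 284)] -/
theorem samuelRank_eq_of_span_singleton_eq {x y : R} (h : Ideal.span ({x} : Set R) = Ideal.span {y})
    (hx : ∃ α : Ordinal.{u}, x ∈ samuelSet R α) : samuelRank x = samuelRank y := by
  have hxy : x ∣ y := Ideal.span_singleton_le_span_singleton.1 h.ge
  have hyx : y ∣ x := Ideal.span_singleton_le_span_singleton.1 h.le
  by_cases hx0 : x = 0
  · subst hx0
    rw [(zero_dvd_iff.1 hxy : y = 0)]
  have hy0 : y ≠ 0 := fun h0 ↦ hx0 (zero_dvd_iff.1 (h0 ▸ hyx))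
  have hy : ∃ α : Ordinal.{u}, y ∈ samuelSet R α := by
    obtain ⟨α, hα⟩ := hx
    obtain ⟨c, rfl⟩ := hyx
    exact ⟨α, mem_samuelSet_of_mul_mem hα hx0⟩
  exact le_antisymm (samuelRank_le_of_dvd hxy hy0 hy) (samuelRank_le_of_dvd hyx hx0 hx)

/-! ## §2 Finitely many principal ideals: `e(R) < ω` (Cor. 17 (a), Fletcher) -/

/-- If `R` has finitely many principal ideals and is exhausted by its construction, `θ` takes finitely many values.
[cite: Clark2015EuclideanOrderTypes, Cor. 17 (a) (proof)] -/
theorem finite_range_samuelRank (h : ∀ z : R, ∃ α : Ordinal.{u}, z ∈ samuelSet R α)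
    (hfin : {I : Ideal R | ∃ x : R, I = Ideal.span {x}}.Finite) : (Set.range (samuelRank : R → Ordinal.{u})).Finite := by
  classical
  -- `θ = g ∘ (x ↦ (x))` for `g(I) = θ` of any generator of `I`
  set P : Set (Ideal R) := {I : Ideal R | ∃ x : R, I = Ideal.span {x}} with hP
  haveI : Finite P := hfin.to_subtype
  let g : P → Ordinal.{u} := fun I ↦ samuelRank (Classical.choose I.2)
  refine (Set.finite_range g).subset ?_
  rintro _ ⟨x, rfl⟩
  refine ⟨⟨Ideal.span {x}, x, rfl⟩, ?_⟩
  have hx : Ideal.span {x} = Ideal.span {Classical.choose (⟨x, rfl⟩ : ∃ y : R, Ideal.span {x} = Ideal.span {y})} :=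
    Classical.choose_spec (⟨x, rfl⟩ : ∃ y : R, Ideal.span {x} = Ideal.span {y})
  exact (samuelRank_eq_of_span_singleton_eq hx (h x)).symm

/-- If `θ` takes finitely many values (on a ring exhausted by its construction) then all of them are finite: the values
are downward closed, so a value `≥ ω` would bring all of `ω` with it. [cite: Clark2015EuclideanOrderTypes, Cor. 17 (a) and
Thm. 14 (c) («`φ_R(R)` is an ordinal»); ConidisNielsenTombs2019, Prop. 4 •3] -/
theorem samuelRank_lt_omega0_of_finite_range (h : ∀ z : R, ∃ α : Ordinal.{u}, z ∈ samuelSet R α)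
    (hfin : (Set.range (samuelRank : R → Ordinal.{u})).Finite) (x : R) : samuelRank x < ω := by
  by_contra hge
  rw [not_lt] at hge
  -- every natural number is a value
  have hsub : Set.range (fun n : ℕ ↦ (n : Ordinal.{u})) ⊆ Set.range (samuelRank : R → Ordinal.{u}) := by
    rintro _ ⟨n, rfl⟩
    obtain ⟨y, hy⟩ := exists_samuelRank_eq_of_lt' h ((Ordinal.natCast_lt_omega0 n).trans_le hge)
    exact ⟨y, hy⟩
  have hinf : (Set.range (fun n : ℕ ↦ (n : Ordinal.{u}))).Infinite :=
    Set.infinite_range_of_injective Nat.cast_injective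
  exact hinf (hfin.subset hsub)

/-- A ring exhausted by its construction on which `θ` takes finitely many values is exhausted at a FINITE stage:
`A_N = R` for some `N < ω`. [cite: Clark2015EuclideanOrderTypes, Cor. 17 (a)] -/
theorem exists_samuelSet_natCast_eq_univ_of_finite_range (h : ∀ z : R, ∃ α : Ordinal.{u}, z ∈ samuelSet R α)
    (hfin : (Set.range (samuelRank : R → Ordinal.{u})).Finite) :
    ∃ N : ℕ, samuelSet R (N : Ordinal.{u}) = Set.univ := by
  -- a finite set of ordinals `< ω` is bounded by a natural number
  obtain ⟨F, hF⟩ := hfin.exists_finset_coe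
  have hnat : ∀ o ∈ F, ∃ n : ℕ, o = n := by
    intro o ho
    have ho' : o ∈ Set.range (samuelRank : R → Ordinal.{u}) := hF ▸ (Finset.mem_coe.2 ho)
    obtain ⟨x, rfl⟩ := ho'
    exact Ordinal.lt_omega0.1 (samuelRank_lt_omega0_of_finite_range h hfin x)
  choose! f hf using hnat
  refine ⟨F.sup f, Set.eq_univ_of_forall fun x ↦ ?_⟩
  have hx : samuelRank x ∈ F := by
    rw [← Finset.mem_coe, hF]
    exact ⟨x, rfl⟩
  refine (mem_samuelSet_iff_samuelRank_le (h x)).2 ?_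
  rw [hf _ hx]
  exact_mod_cast Finset.le_sup (f := f) hx

/-- **Cor. 17 (a) (Fletcher): finitely many principal ideals ⟹ `e(R) < ω`** (for `R` exhausted by its transfinite
construction — e.g. an Artinian principal, in particular a finite principal, ring: «an Artinian principal ring has only
finitely many ideals!»). [cite: Clark2015EuclideanOrderTypes, Cor. 17 (a)] -/
theorem iSup_samuelRank_lt_omega0_of_finite_setOf_span_singleton (h : ∀ z : R, ∃ α : Ordinal.{u}, z ∈ samuelSet R α)
    (hfin : {I : Ideal R | ∃ x : R, I = Ideal.span {x}}.Finite) : (⨆ z : R, (samuelRank z - 1 + 1)) < ω := by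
  obtain ⟨N, hN⟩ := exists_samuelSet_natCast_eq_univ_of_finite_range h (finite_range_samuelRank h hfin)
  refine lt_of_le_of_lt (Ordinal.iSup_le fun z ↦ ?_) (Ordinal.natCast_lt_omega0 (N + 1))
  have hz : samuelRank z ≤ (N : Ordinal.{u}) := samuelRank_le_of_mem (Set.eq_univ_iff_forall.1 hN z)
  calc samuelRank z - 1 + 1 ≤ samuelRank z + 1 := add_le_add (Ordinal.sub_le_self _ _) le_rfl
    _ ≤ (N : Ordinal.{u}) + 1 := add_le_add hz le_rfl
    _ = ((N + 1 : ℕ) : Ordinal.{u}) := by rw [Nat.cast_succ]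

/-- In particular **a FINITE ring exhausted by its transfinite construction has `e(R) < ω`** (and is Euclidean for a
bounded `ℕ`-valued function). [cite: Clark2015EuclideanOrderTypes, Cor. 17 (a)] -/
theorem iSup_samuelRank_lt_omega0_of_finite [Finite R] (h : ∀ z : R, ∃ α : Ordinal.{u}, z ∈ samuelSet R α) :
    (⨆ z : R, (samuelRank z - 1 + 1)) < ω :=
  iSup_samuelRank_lt_omega0_of_finite_setOf_span_singleton h
    ((Set.finite_range fun x : R ↦ Ideal.span ({x} : Set R)).subset (by rintro _ ⟨x, rfl⟩; exact ⟨x, rfl⟩))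

/-- … and some finite stage of a finite exhausted ring is everything. [cite: Clark2015EuclideanOrderTypes, Cor. 17 (a)] -/
theorem exists_samuelSet_natCast_eq_univ_of_finite [Finite R] (h : ∀ z : R, ∃ α : Ordinal.{u}, z ∈ samuelSet R α) :
    ∃ N : ℕ, samuelSet R (N : Ordinal.{u}) = Set.univ :=
  exists_samuelSet_natCast_eq_univ_of_finite_range h ((Set.finite_range _).subset fun _ h ↦ h)

/-! ## §3 `θ(x) < ω` forces DCC on the principal ideals above `x` (Thm. 16 (a)) -/

/-- Along a strictly descending chain of principal ideals `(y₀) ⊋ (y₁) ⊋ …` all containing a fixed `x ∈ A′ ∖ 0`, the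
values `θ(y_n)` increase strictly: `n ≤ θ(y_n) ≤ θ(x)`. [cite: Clark2015EuclideanOrderTypes, Thm. 16 (a) (proof)] -/
theorem natCast_le_samuelRank_of_chain {x : R} (hx0 : x ≠ 0) (hx : ∃ α : Ordinal.{u}, x ∈ samuelSet R α)
    (y : ℕ → R) (hdvd : ∀ n, y n ∣ x) (hlt : ∀ n, Ideal.span ({y (n + 1)} : Set R) < Ideal.span {y n}) (n : ℕ) :
    (n : Ordinal.{u}) ≤ samuelRank (y n) ∧ samuelRank (y n) ≤ samuelRank x := by
  have hy0 : ∀ n, y n ≠ 0 := fun n h0 ↦ hx0 (zero_dvd_iff.1 (h0 ▸ hdvd n))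
  have hye : ∀ n, ∃ α : Ordinal.{u}, y n ∈ samuelSet R α := fun n ↦ by
    obtain ⟨α, hα⟩ := hx
    obtain ⟨c, hc⟩ := hdvd n
    exact ⟨α, mem_samuelSet_of_mul_mem (hc ▸ hα) (hc ▸ hx0)⟩
  refine ⟨?_, samuelRank_le_of_dvd (hdvd n) hx0 hx⟩
  induction n with
  | zero => exact_mod_cast bot_le
  | succ n ih =>
    have hstep : samuelRank (y n) < samuelRank (y (n + 1)) :=
      samuelRank_lt_of_dvd_of_span_singleton_ne (Ideal.span_singleton_le_span_singleton.1 (hlt n).le)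
        (hlt n).ne (hy0 _) (hye _)
    rw [Nat.cast_succ]
    exact Order.add_one_le_iff.2 (ih.trans_lt hstep)

/-- **Thm. 16 (a), chain form: if `θ(x) < ω` (`x ≠ 0`, `x ∈ A′`) there is no infinite strictly descending chain of principal
ideals all of which contain `x`** — the principal ideals of `R/(x)` satisfy DCC («`R/(x)` is Artinian» for a principal
ring). [cite: Clark2015EuclideanOrderTypes, Thm. 16 (a)] -/
theorem not_exists_chain_of_samuelRank_lt_omega0 {x : R} (hx0 : x ≠ 0) (hx : ∃ α : Ordinal.{u}, x ∈ samuelSet R α)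
    (hω : samuelRank x < ω) :
    ¬∃ y : ℕ → R, (∀ n, y n ∣ x) ∧ ∀ n, Ideal.span ({y (n + 1)} : Set R) < Ideal.span {y n} := by
  rintro ⟨y, hdvd, hlt⟩
  obtain ⟨m, hm⟩ := Ordinal.lt_omega0.1 hω
  obtain ⟨h1, h2⟩ := natCast_le_samuelRank_of_chain hx0 hx y hdvd hlt (m + 1)
  have : ((m + 1 : ℕ) : Ordinal.{u}) ≤ (m : Ordinal.{u}) := hm ▸ h1.trans h2
  exact absurd (by exact_mod_cast this : m + 1 ≤ m) (by omega)

/-- Hence in a SMALL ring (all `θ(x) < ω`, e.g. `e(R) ≤ ω`) every non-zero `x ∈ A′` has DCC on the principal ideals above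
it. [cite: Clark2015EuclideanOrderTypes, Thm. 16 (a)] -/
theorem not_exists_chain_of_forall_samuelRank_lt_omega0 (h : ∀ z : R, ∃ α : Ordinal.{u}, z ∈ samuelSet R α)
    (hω : ∀ z : R, samuelRank z < ω) {x : R} (hx0 : x ≠ 0) :
    ¬∃ y : ℕ → R, (∀ n, y n ∣ x) ∧ ∀ n, Ideal.span ({y (n + 1)} : Set R) < Ideal.span {y n} :=
  not_exists_chain_of_samuelRank_lt_omega0 hx0 (h x) (hω x)

end Literature.Algebra.EuclideanDomain
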